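import Summits.QuantumFields.BalabanUV.Beta.D1BFx.KCombineCov
import Summits.QuantumFields.BalabanUV.Beta.D1BFx.ColourLiftPackedHess

/-!
# `BalabanUV.Beta.D1BFx.KCombineCovColour` — road «BF-x» for binder row D1, slot (K), (K) CLOSURE PLAN (R1-L) §2 (A1): **«K-COV-C» — THE
# COLOUR-STRIPPED SLICE TRANSFER OF THE COVARIANT ORGANISATION** (F-g6-1's parity ∕ colour typing applied to the (R1-L) twin `KCombineCov`).
# `KCombineCov.hessT_transfer_wardL` (p251661 §2) — hence its per-torus dictionary steps §3 ∕ §3′ — is stated for HONEST symmetric form jets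
# `Kₛᵀ = Kₛ`, `Aₛᵀ = Aₛ` (it derives the transposed Ward letters from symmetry).  The cell's kernels are COLOURLESS instances (owner FINDING
# F-g6-1, journal l.22386): first-order tables parity-ODD, i.e. the stripped first form jets `kₛ` are ANTISYMMETRIC, and so are TB4-W's first
# Gram ∕ inverse jets (`TorusCoframeJets.transpose_Gjet₁ : (Gjet₁)ᵀ = −Gjet₁`, `Ajet₁ = −2•G₀⁻¹G₁G₀⁻¹`); fed directly with them the symmetric
# hypotheses FAIL (they would force `kₛW₀ = 0 ∧ K₀wₛ = 0` separately).  THIS MODULE is the (R1-L) analogue of K-TA4C (`ColourLift` ∕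
# `GramWeightColourLift` ∕ `ColourLiftPackedHess`, gan24-leaf-03-g44): `hessT_transfer_wardL` at the colour-LIFTED data `1⊗K₀, c⊗kₛ, (c·c)⊗kₛₜ, …`
# (any antisymmetric `c`; every lifted jet IS symmetric by the parity types), every one-loop functional carrying the uniform factor `tr(c·c)`,
# and — `c = cgen`, `tr C² = −2` cancelled — THE STRIPPED IDENTITY for colourless typed data under the COLOURLESS ONE-SIDED WARD-L letters only.

HONEST FRAMING (cell contract, verbatim): «discharging `BetaPertH` makes Bałaban's UV stability UNCONDITIONAL — a real constructive-QFT
result; it is NOT the continuum limit and NOT the Clay problem.»  HONEST DEPENDENCY (verbatim): «continuum YM on T⁴ ⇐ BetaPertH ∧ nine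
spine estimates (0/9 proved); BetaPertH ⇐ (D1) ∧ (D4) ∧ CAP+tail; G-an2-4 gates asym, D1 and NE2/3/4.»  THIS MODULE DISCHARGES NOTHING of
D1 ∕ BetaPertH: [folklore] finite-dimensional linear algebra — `KCombineCov.hessT_transfer_wardL` at Kronecker-lifted matrices and the K-TA4C
lift ∕ strip lemmas (`kkt_kronecker₂`, `kkt_kronecker_symm`, `submatrix_reindex_e₃`, `hessT_reindex_lift`, `hessT_kronecker_lift`, `lift_rel•`,
`gram•_lift`, `det_•_ne_zero`) BY NAME.  No `def`, no `def … : Prop`, nothing cited, 0 sorry.  It does NOT decide the road's table dictionary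
((A2-M∕N): which periodised tables are `kₛ`, `qₛ`, …), does NOT prove WARD-L (Q1), does NOT touch the END.  NOT summit progress; NOT BetaPertH,
NOT continuum, NOT Clay.

ABSOLUTE RULE (cell, verbatim): «No internally-minted statement may enter as a cited fact. Every hypothesis is either kernel-proved in this
package or a verbatim quotation of a PUBLISHED theorem with page reference. The manuscript(s) under audit are NOT citable for their own
disputed steps — they are the thing under adjudication; programme-internal (2001/route/tribunal) claims are never citable.»

CONTENT (all [folklore]; `Y₀ := K₀ + gram₀ T₀ A₀`, twisted totals `ỹₛ := kₛ + tgram₁ T₀ tₛ A₀ Aₛ`, `ỹₛₜ := kₛₜ + tgramMix T₀ tₛ tₜ tₛₜ A₀ Aₛ Aₜ Aₛₜ`).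
* §1 lift bookkeeping: `one_kronecker_add_gram₀` (`1⊗K₀ + gram₀ (1⊗T₀) (1⊗A₀) = 1 ⊗ Y₀`), `kronecker_add_gram₁` (`c⊗kₛ + gram₁ (…) = c ⊗ ỹₛ`),
  `sq_kronecker_add_gramMix`, `transpose_kronecker_of_antisymm` (`(c⊗k)ᵀ = c⊗k` for `cᵀ = −c`, `kᵀ = −k`), `transpose_one_kronecker`, `transpose_sq_kronecker`,
  `inv_reindex_one_kronecker`, `inv_one_kronecker`, `kkt_kronecker₂_tj₂` (`kkt (c⊗k) (c⊗q) = e₂-reindex of c ⊗ tj₂ k q`).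
* §2 **`hessT_transfer_wardL_lift`** — `KCombineCov.hessT_transfer_wardL` AT THE LIFTED DATA from the COLOURLESS one-sided letters + the parity
  types (`K₀`, `kₛₜ`, `A₀`, `Aₛₜ` symmetric; `kₛ`, `kₜ`, `Aₛ`, `Aₜ` antisymmetric) + the five `det ≠ 0`; any antisymmetric `c`.
* §3 **`hessT_transfer_wardL_stripped_mul`** (`tr(c·c) ×` both sides) and **`hessT_transfer_wardL_stripped`** (`c = cgen`): THE c-FREE IDENTITY
  `hessT (M⁻¹|_{ν⊕μ}; tj₂ kₛ qₛ, tj₂ kₜ qₜ, kkt kₛₜ qₛₜ) + hessT (Φ₀⁻¹; tgram₁ W₀ wₛ Y₀ ỹₛ, tgram₁ W₀ wₜ Y₀ ỹₜ, tgramMix W₀ w• Y₀ ỹ•)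
   = hessT ((kkt Y₀ Q₀)⁻¹; tj₂ ỹₛ qₛ, tj₂ ỹₜ qₜ, kkt ỹₛₜ qₛₜ) + 2·hessT ((τW₀)⁻¹; τwₛ, τwₜ, τwₛₜ)`, `M = kkt K₀ [Q₀;τ]`, `Φ₀ = gram₀ W₀ Y₀`
  — signed first jets `tj₂ k q = [[k, −qᵀ],[q, 0]]`, untwisted second jets, TWISTED Gram jets; hypotheses = parity types + ONE-SIDED letters + dets.
* §4 `hessT_tj₂_eq_placed`, `hessT_stripped_M_placed` — the M-side in the cell's `D`-placement (`tj₂ k q = kkt k q · D`, `D = diag(1,−1)`,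
  `ColourLiftPackedHess.tj₂_eq_kkt_mul_sgn`): against a leg read as `D·L` (TB1's `hessT_inv_MT_corner`) the stripped M-side functional is
  `hessT L (kkt kₛ qₛ) (kkt kₜ qₜ) (kkt kₛₜ qₛₜ · D)` — first-order tables PLAIN, second-order `· D` (F-g6-1's `V = j·D`, `W = w·D`).
Unit `b2b-balaban-beta-d1-formalise-leaf-03` (gen 11); road owner `b2b-balaban-beta-d1-p2`; pattern = K-TA4C (gan24-leaf-03-g44).
-/

noncomputable section

namespace Summit.QuantumFields.BalabanUV.Beta.D1BFx.KCombineCovColour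

open Matrix
open scoped Kronecker
open Literature.MathematicalPhysics.QuantumFieldTheory.Balaban1983to89.Beta.Composition (kkt)
open Summit.QuantumFields.BalabanUV.Beta.D1BFx.MixedVarPackedHess (hessT)
open Summit.QuantumFields.BalabanUV.Beta.D1BFx.GramWeightJets (gram₀ gram₁)
open Summit.QuantumFields.BalabanUV.Beta.D1BFx.GramWeightJetsMixed (gramMix)
open Summit.QuantumFields.BalabanUV.Beta.D1BFx.GramWeightColourLift (tj₂ tgram₁ tgramMix hc_smul gram₀_lift gram₁_lift gramMix_lift lift_mul)
open Summit.QuantumFields.BalabanUV.Beta.D1BFx.ColourLift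
open Summit.QuantumFields.BalabanUV.Beta.D1BFx.ColourLiftPackedHess (tj₂_eq_kkt_mul_sgn sgn_mul_sgn hessT_placement)
open Summit.QuantumFields.BalabanUV.Beta.D1BFx.KCombineCov (hessT_transfer_wardL)

/-! ## §1 Lift bookkeeping -/

section LiftLemmas

variable {l ν μ ρ : Type*} {c : Matrix l l ℝ}

/-- [folklore] The lifted zeroth total: `1⊗K₀ + gram₀ (1⊗T₀) (1⊗A₀) = 1 ⊗ (K₀ + gram₀ T₀ A₀)`. -/
theorem one_kronecker_add_gram₀ [Fintype l] [DecidableEq l] [Fintype ρ] (K₀ : Matrix ν ν ℝ) (T₀ : Matrix ρ ν ℝ) (A₀ : Matrix ρ ρ ℝ) :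
    (1 : Matrix l l ℝ) ⊗ₖ K₀ + gram₀ ((1 : Matrix l l ℝ) ⊗ₖ T₀) ((1 : Matrix l l ℝ) ⊗ₖ A₀) = (1 : Matrix l l ℝ) ⊗ₖ (K₀ + gram₀ T₀ A₀) := by
  rw [gram₀_lift, ← Matrix.kronecker_add]

/-- [folklore] The lifted first total (twisted): `c⊗k + gram₁ (1⊗T₀) (c⊗t) (1⊗A₀) (c⊗a) = c ⊗ (k + tgram₁ T₀ t A₀ a)` (`cᵀ = −c`). -/
theorem kronecker_add_gram₁ [Fintype l] [DecidableEq l] [Fintype ρ] (hc : cᵀ = -c) (k : Matrix ν ν ℝ) (T₀ t : Matrix ρ ν ℝ) (A₀ a : Matrix ρ ρ ℝ) :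
    c ⊗ₖ k + gram₁ ((1 : Matrix l l ℝ) ⊗ₖ T₀) (c ⊗ₖ t) ((1 : Matrix l l ℝ) ⊗ₖ A₀) (c ⊗ₖ a) = c ⊗ₖ (k + tgram₁ T₀ t A₀ a) := by
  rw [gram₁_lift hc, ← Matrix.kronecker_add]

/-- [folklore] The lifted mixed total (twisted): `(c·c)⊗k + gramMix (…) = (c·c) ⊗ (k + tgramMix T₀ tₛ tₜ tₛₜ A₀ Aₛ Aₜ Aₛₜ)`. -/
theorem sq_kronecker_add_gramMix [Fintype l] [DecidableEq l] [Fintype ρ] (hc : cᵀ = -c) (k : Matrix ν ν ℝ) (T₀ tₛ tₜ tₛₜ : Matrix ρ ν ℝ)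
    (A₀ Aₛ Aₜ Aₛₜ : Matrix ρ ρ ℝ) :
    (c * c) ⊗ₖ k + gramMix ((1 : Matrix l l ℝ) ⊗ₖ T₀) (c ⊗ₖ tₛ) (c ⊗ₖ tₜ) ((c * c) ⊗ₖ tₛₜ)
        ((1 : Matrix l l ℝ) ⊗ₖ A₀) (c ⊗ₖ Aₛ) (c ⊗ₖ Aₜ) ((c * c) ⊗ₖ Aₛₜ)
      = (c * c) ⊗ₖ (k + tgramMix T₀ tₛ tₜ tₛₜ A₀ Aₛ Aₜ Aₛₜ) := by
  rw [gramMix_lift hc, ← Matrix.kronecker_add]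

/-- [folklore] PARITY TYPES CONSUMED: an antisymmetric colour factor times an ANTISYMMETRIC stripped jet is a SYMMETRIC lifted jet. -/
theorem transpose_kronecker_of_antisymm (hc : cᵀ = -c) {k : Matrix ν ν ℝ} (hk : kᵀ = -k) : (c ⊗ₖ k)ᵀ = c ⊗ₖ k := by
  rw [kronecker_transpose', hc, hk, neg_kronecker_neg]

/-- [folklore] `(1⊗K)ᵀ = 1⊗K` for symmetric `K`. -/
theorem transpose_one_kronecker [DecidableEq l] {K : Matrix ν ν ℝ} (hK : Kᵀ = K) : ((1 : Matrix l l ℝ) ⊗ₖ K)ᵀ = (1 : Matrix l l ℝ) ⊗ₖ K := by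
  rw [kronecker_transpose', Matrix.transpose_one, hK]

/-- [folklore] `((c·c)⊗K)ᵀ = (c·c)⊗K` for antisymmetric `c` and symmetric `K`. -/
theorem transpose_sq_kronecker [Fintype l] (hc : cᵀ = -c) {K : Matrix ν ν ℝ} (hK : Kᵀ = K) : ((c * c) ⊗ₖ K)ᵀ = (c * c) ⊗ₖ K := by
  rw [kronecker_transpose', sq_transpose hc, hK]

/-- [folklore] `(1 ⊗ X)⁻¹ = 1 ⊗ X⁻¹`. -/
theorem inv_one_kronecker [Fintype l] [DecidableEq l] [Fintype ν] [DecidableEq ν] (X : Matrix ν ν ℝ) :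
    ((1 : Matrix l l ℝ) ⊗ₖ X)⁻¹ = (1 : Matrix l l ℝ) ⊗ₖ X⁻¹ := by
  rw [Matrix.inv_kronecker, inv_one]

/-- [folklore] `(reindex e e (1 ⊗ X))⁻¹ = reindex e e (1 ⊗ X⁻¹)`. -/
theorem inv_reindex_one_kronecker [Fintype l] [DecidableEq l] [Fintype ν] [DecidableEq ν] {κ : Type*} [Fintype κ] [DecidableEq κ]
    (e : l × ν ≃ κ) (X : Matrix ν ν ℝ) :
    (reindex e e ((1 : Matrix l l ℝ) ⊗ₖ X))⁻¹ = reindex e e ((1 : Matrix l l ℝ) ⊗ₖ X⁻¹) := by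
  rw [Matrix.inv_reindex, inv_one_kronecker]

/-- [folklore] The lifted signed first jet: `kkt (c⊗k) (c⊗q) = e₂-reindex of c ⊗ tj₂ k q` (`cᵀ = −c`). -/
theorem kkt_kronecker₂_tj₂ (hc : cᵀ = -c) (k : Matrix ν ν ℝ) (q : Matrix μ ν ℝ) :
    kkt (c ⊗ₖ k) (c ⊗ₖ q) = reindex (e₂ l ν μ) (e₂ l ν μ) (c ⊗ₖ tj₂ k q) := by
  rw [kkt_kronecker₂ (hc_smul hc), neg_one_smul]
  rfl

/-- [folklore] The packed corner of the lifted comb KKT inverse: `((e₃-reindex of 1⊗M)⁻¹)|_{ν⊕μ} = e₂-reindex of 1 ⊗ (M⁻¹|_{ν⊕μ})`. -/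
theorem corner_inv_lift [Fintype l] [DecidableEq l] [Fintype ν] [DecidableEq ν] [Fintype μ] [DecidableEq μ] [Fintype ρ] [DecidableEq ρ]
    (M : Matrix (ν ⊕ (μ ⊕ ρ)) (ν ⊕ (μ ⊕ ρ)) ℝ) :
    ((reindex (e₃ l ν μ ρ) (e₃ l ν μ ρ) ((1 : Matrix l l ℝ) ⊗ₖ M))⁻¹).submatrix (Sum.map id Sum.inl) (Sum.map id Sum.inl)
      = reindex (e₂ l ν μ) (e₂ l ν μ) ((1 : Matrix l l ℝ) ⊗ₖ M⁻¹.submatrix (Sum.map id Sum.inl) (Sum.map id Sum.inl)) := by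
  rw [inv_reindex_one_kronecker, submatrix_reindex_e₃]

end LiftLemmas

/-! ## §2 `hessT_transfer_wardL` at the lifted data -/

section Lift

variable {l ν μ ρ : Type*} [Fintype l] [Fintype ν] [Fintype μ] [Fintype ρ] [DecidableEq l] [DecidableEq ν] [DecidableEq μ] [DecidableEq ρ]
variable {c : Matrix l l ℝ}

/-- [folklore] **THE (R1-L) SLICE TRANSFER AT THE COLOUR-LIFTED DATA.**  COLOURLESS typed data: `K₀`, `kₛₜ`, `A₀`, `Aₛₜ` symmetric; `kₛ`, `kₜ`,
`Aₛ`, `Aₜ` ANTISYMMETRIC; co-frame, gauge-basis and constraint jets untyped; comb rows `τ`.  HYPOTHESES = the COLOURLESS ONE-SIDED WARD-L letters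
(a0), (aₛ), (aₜ), (aₛₜ), the kinematic letters (b0)…(bₛₜ), the parity types, the five `det ≠ 0`.  CONCLUSION = `KCombineCov.hessT_transfer_wardL`
for the lifted matrices (zeroth jets `1 ⊗ ·`, first jets `c ⊗ ·`, second jets `(c·c) ⊗ ·`), ANY antisymmetric colour matrix `c`. -/
theorem hessT_transfer_wardL_lift (hc : cᵀ = -c)
    (K₀ kₛ kₜ kₛₜ : Matrix ν ν ℝ) (T₀ tₛ tₜ tₛₜ : Matrix ρ ν ℝ) (A₀ Aₛ Aₜ Aₛₜ : Matrix ρ ρ ℝ)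
    (W₀ wₛ wₜ wₛₜ : Matrix ν ρ ℝ) (Q₀ qₛ qₜ qₛₜ : Matrix μ ν ℝ) (τ : Matrix ρ ν ℝ)
    (hK₀ : K₀ᵀ = K₀) (hkₛ : kₛᵀ = -kₛ) (hkₜ : kₜᵀ = -kₜ) (hkₛₜ : kₛₜᵀ = kₛₜ)
    (hA₀ : A₀ᵀ = A₀) (hAₛ : Aₛᵀ = -Aₛ) (hAₜ : Aₜᵀ = -Aₜ) (hAₛₜ : Aₛₜᵀ = Aₛₜ)
    (a0 : K₀ * W₀ = 0) (aₛ : kₛ * W₀ + K₀ * wₛ = 0) (aₜ : kₜ * W₀ + K₀ * wₜ = 0)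
    (aₛₜ : kₛₜ * W₀ + kₛ * wₜ + kₜ * wₛ + K₀ * wₛₜ = 0)
    (b0 : Q₀ * W₀ = 0) (bₛ : qₛ * W₀ + Q₀ * wₛ = 0) (bₜ : qₜ * W₀ + Q₀ * wₜ = 0)
    (bₛₜ : qₛₜ * W₀ + qₛ * wₜ + qₜ * wₛ + Q₀ * wₛₜ = 0)
    (hTW : (T₀ * W₀).det ≠ 0) (hA : A₀.det ≠ 0) (hΦ : (gram₀ W₀ (K₀ + gram₀ T₀ A₀)).det ≠ 0) (hτ : (τ * W₀).det ≠ 0)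
    (hM : (kkt K₀ (fromRows Q₀ τ)).det ≠ 0) :
    hessT ((kkt ((1 : Matrix l l ℝ) ⊗ₖ K₀) (fromRows ((1 : Matrix l l ℝ) ⊗ₖ Q₀) ((1 : Matrix l l ℝ) ⊗ₖ τ)))⁻¹.submatrix
          (Sum.map id Sum.inl) (Sum.map id Sum.inl))
        (kkt (c ⊗ₖ kₛ) (c ⊗ₖ qₛ)) (kkt (c ⊗ₖ kₜ) (c ⊗ₖ qₜ)) (kkt ((c * c) ⊗ₖ kₛₜ) ((c * c) ⊗ₖ qₛₜ))
      + hessT (gram₀ ((1 : Matrix l l ℝ) ⊗ₖ W₀) ((1 : Matrix l l ℝ) ⊗ₖ K₀ + gram₀ ((1 : Matrix l l ℝ) ⊗ₖ T₀) ((1 : Matrix l l ℝ) ⊗ₖ A₀)))⁻¹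
          (gram₁ ((1 : Matrix l l ℝ) ⊗ₖ W₀) (c ⊗ₖ wₛ) ((1 : Matrix l l ℝ) ⊗ₖ K₀ + gram₀ ((1 : Matrix l l ℝ) ⊗ₖ T₀) ((1 : Matrix l l ℝ) ⊗ₖ A₀))
            (c ⊗ₖ kₛ + gram₁ ((1 : Matrix l l ℝ) ⊗ₖ T₀) (c ⊗ₖ tₛ) ((1 : Matrix l l ℝ) ⊗ₖ A₀) (c ⊗ₖ Aₛ)))
          (gram₁ ((1 : Matrix l l ℝ) ⊗ₖ W₀) (c ⊗ₖ wₜ) ((1 : Matrix l l ℝ) ⊗ₖ K₀ + gram₀ ((1 : Matrix l l ℝ) ⊗ₖ T₀) ((1 : Matrix l l ℝ) ⊗ₖ A₀))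
            (c ⊗ₖ kₜ + gram₁ ((1 : Matrix l l ℝ) ⊗ₖ T₀) (c ⊗ₖ tₜ) ((1 : Matrix l l ℝ) ⊗ₖ A₀) (c ⊗ₖ Aₜ)))
          (gramMix ((1 : Matrix l l ℝ) ⊗ₖ W₀) (c ⊗ₖ wₛ) (c ⊗ₖ wₜ) ((c * c) ⊗ₖ wₛₜ)
            ((1 : Matrix l l ℝ) ⊗ₖ K₀ + gram₀ ((1 : Matrix l l ℝ) ⊗ₖ T₀) ((1 : Matrix l l ℝ) ⊗ₖ A₀))
            (c ⊗ₖ kₛ + gram₁ ((1 : Matrix l l ℝ) ⊗ₖ T₀) (c ⊗ₖ tₛ) ((1 : Matrix l l ℝ) ⊗ₖ A₀) (c ⊗ₖ Aₛ))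
            (c ⊗ₖ kₜ + gram₁ ((1 : Matrix l l ℝ) ⊗ₖ T₀) (c ⊗ₖ tₜ) ((1 : Matrix l l ℝ) ⊗ₖ A₀) (c ⊗ₖ Aₜ))
            ((c * c) ⊗ₖ kₛₜ + gramMix ((1 : Matrix l l ℝ) ⊗ₖ T₀) (c ⊗ₖ tₛ) (c ⊗ₖ tₜ) ((c * c) ⊗ₖ tₛₜ)
              ((1 : Matrix l l ℝ) ⊗ₖ A₀) (c ⊗ₖ Aₛ) (c ⊗ₖ Aₜ) ((c * c) ⊗ₖ Aₛₜ)))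
    = hessT (kkt ((1 : Matrix l l ℝ) ⊗ₖ K₀ + gram₀ ((1 : Matrix l l ℝ) ⊗ₖ T₀) ((1 : Matrix l l ℝ) ⊗ₖ A₀)) ((1 : Matrix l l ℝ) ⊗ₖ Q₀))⁻¹
          (kkt (c ⊗ₖ kₛ + gram₁ ((1 : Matrix l l ℝ) ⊗ₖ T₀) (c ⊗ₖ tₛ) ((1 : Matrix l l ℝ) ⊗ₖ A₀) (c ⊗ₖ Aₛ)) (c ⊗ₖ qₛ))
          (kkt (c ⊗ₖ kₜ + gram₁ ((1 : Matrix l l ℝ) ⊗ₖ T₀) (c ⊗ₖ tₜ) ((1 : Matrix l l ℝ) ⊗ₖ A₀) (c ⊗ₖ Aₜ)) (c ⊗ₖ qₜ))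
          (kkt ((c * c) ⊗ₖ kₛₜ + gramMix ((1 : Matrix l l ℝ) ⊗ₖ T₀) (c ⊗ₖ tₛ) (c ⊗ₖ tₜ) ((c * c) ⊗ₖ tₛₜ)
              ((1 : Matrix l l ℝ) ⊗ₖ A₀) (c ⊗ₖ Aₛ) (c ⊗ₖ Aₜ) ((c * c) ⊗ₖ Aₛₜ)) ((c * c) ⊗ₖ qₛₜ))
      + 2 * hessT ((1 : Matrix l l ℝ) ⊗ₖ τ * ((1 : Matrix l l ℝ) ⊗ₖ W₀))⁻¹ ((1 : Matrix l l ℝ) ⊗ₖ τ * (c ⊗ₖ wₛ))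
          ((1 : Matrix l l ℝ) ⊗ₖ τ * (c ⊗ₖ wₜ)) ((1 : Matrix l l ℝ) ⊗ₖ τ * ((c * c) ⊗ₖ wₛₜ)) := by
  have hΦL : (gram₀ ((1 : Matrix l l ℝ) ⊗ₖ W₀) ((1 : Matrix l l ℝ) ⊗ₖ K₀
      + gram₀ ((1 : Matrix l l ℝ) ⊗ₖ T₀) ((1 : Matrix l l ℝ) ⊗ₖ A₀))).det ≠ 0 := by
    rw [one_kronecker_add_gram₀, gram₀_lift]
    exact det_one_kronecker_ne_zero hΦ
  exact hessT_transfer_wardL ((1 : Matrix l l ℝ) ⊗ₖ K₀) (c ⊗ₖ kₛ) (c ⊗ₖ kₜ) ((c * c) ⊗ₖ kₛₜ)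
    ((1 : Matrix l l ℝ) ⊗ₖ T₀) (c ⊗ₖ tₛ) (c ⊗ₖ tₜ) ((c * c) ⊗ₖ tₛₜ)
    ((1 : Matrix l l ℝ) ⊗ₖ A₀) (c ⊗ₖ Aₛ) (c ⊗ₖ Aₜ) ((c * c) ⊗ₖ Aₛₜ)
    ((1 : Matrix l l ℝ) ⊗ₖ W₀) (c ⊗ₖ wₛ) (c ⊗ₖ wₜ) ((c * c) ⊗ₖ wₛₜ)
    ((1 : Matrix l l ℝ) ⊗ₖ Q₀) (c ⊗ₖ qₛ) (c ⊗ₖ qₜ) ((c * c) ⊗ₖ qₛₜ) ((1 : Matrix l l ℝ) ⊗ₖ τ)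
    (transpose_one_kronecker hK₀) (transpose_kronecker_of_antisymm hc hkₛ) (transpose_kronecker_of_antisymm hc hkₜ)
    (transpose_sq_kronecker hc hkₛₜ)
    (transpose_one_kronecker hA₀) (transpose_kronecker_of_antisymm hc hAₛ) (transpose_kronecker_of_antisymm hc hAₜ)
    (transpose_sq_kronecker hc hAₛₜ)
    (lift_rel₀ a0) (lift_rel₁ c aₛ) (lift_rel₁ c aₜ) (lift_rel_mix c aₛₜ)
    (lift_rel₀ b0) (lift_rel₁ c bₛ) (lift_rel₁ c bₜ) (lift_rel_mix c bₛₜ)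
    (det_lift_mul_ne_zero hTW) (det_one_kronecker_ne_zero hA) hΦL (det_lift_mul_ne_zero hτ) (det_kkt_lift_ne_zero hM)

end Lift

/-! ## §3 The stripped (colour-free) identity -/

section Strip

variable {l ν μ ρ : Type*} [Fintype l] [Fintype ν] [Fintype μ] [Fintype ρ] [DecidableEq l] [DecidableEq ν] [DecidableEq μ] [DecidableEq ρ]
variable {c : Matrix l l ℝ}

/-- [folklore] **THE STRIPPED (R1-L) SLICE TRANSFER, UP TO THE COLOUR FACTOR `tr(c·c)`** (any antisymmetric `c`): the colourless one-sided
letters + parity types + five `det ≠ 0` give `tr(c·c)·[LHS stripped] = tr(c·c)·[RHS stripped]` (statement of `hessT_transfer_wardL_stripped`). -/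
theorem hessT_transfer_wardL_stripped_mul (hc : cᵀ = -c)
    (K₀ kₛ kₜ kₛₜ : Matrix ν ν ℝ) (T₀ tₛ tₜ tₛₜ : Matrix ρ ν ℝ) (A₀ Aₛ Aₜ Aₛₜ : Matrix ρ ρ ℝ)
    (W₀ wₛ wₜ wₛₜ : Matrix ν ρ ℝ) (Q₀ qₛ qₜ qₛₜ : Matrix μ ν ℝ) (τ : Matrix ρ ν ℝ)
    (hK₀ : K₀ᵀ = K₀) (hkₛ : kₛᵀ = -kₛ) (hkₜ : kₜᵀ = -kₜ) (hkₛₜ : kₛₜᵀ = kₛₜ)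
    (hA₀ : A₀ᵀ = A₀) (hAₛ : Aₛᵀ = -Aₛ) (hAₜ : Aₜᵀ = -Aₜ) (hAₛₜ : Aₛₜᵀ = Aₛₜ)
    (a0 : K₀ * W₀ = 0) (aₛ : kₛ * W₀ + K₀ * wₛ = 0) (aₜ : kₜ * W₀ + K₀ * wₜ = 0)
    (aₛₜ : kₛₜ * W₀ + kₛ * wₜ + kₜ * wₛ + K₀ * wₛₜ = 0)
    (b0 : Q₀ * W₀ = 0) (bₛ : qₛ * W₀ + Q₀ * wₛ = 0) (bₜ : qₜ * W₀ + Q₀ * wₜ = 0)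
    (bₛₜ : qₛₜ * W₀ + qₛ * wₜ + qₜ * wₛ + Q₀ * wₛₜ = 0)
    (hTW : (T₀ * W₀).det ≠ 0) (hA : A₀.det ≠ 0) (hΦ : (gram₀ W₀ (K₀ + gram₀ T₀ A₀)).det ≠ 0) (hτ : (τ * W₀).det ≠ 0)
    (hM : (kkt K₀ (fromRows Q₀ τ)).det ≠ 0) :
    (c * c).trace *
        (hessT ((kkt K₀ (fromRows Q₀ τ))⁻¹.submatrix (Sum.map id Sum.inl) (Sum.map id Sum.inl)) (tj₂ kₛ qₛ) (tj₂ kₜ qₜ) (kkt kₛₜ qₛₜ)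
          + hessT (gram₀ W₀ (K₀ + gram₀ T₀ A₀))⁻¹
              (tgram₁ W₀ wₛ (K₀ + gram₀ T₀ A₀) (kₛ + tgram₁ T₀ tₛ A₀ Aₛ))
              (tgram₁ W₀ wₜ (K₀ + gram₀ T₀ A₀) (kₜ + tgram₁ T₀ tₜ A₀ Aₜ))
              (tgramMix W₀ wₛ wₜ wₛₜ (K₀ + gram₀ T₀ A₀) (kₛ + tgram₁ T₀ tₛ A₀ Aₛ) (kₜ + tgram₁ T₀ tₜ A₀ Aₜ)
                (kₛₜ + tgramMix T₀ tₛ tₜ tₛₜ A₀ Aₛ Aₜ Aₛₜ)))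
      = (c * c).trace *
        (hessT (kkt (K₀ + gram₀ T₀ A₀) Q₀)⁻¹ (tj₂ (kₛ + tgram₁ T₀ tₛ A₀ Aₛ) qₛ) (tj₂ (kₜ + tgram₁ T₀ tₜ A₀ Aₜ) qₜ)
            (kkt (kₛₜ + tgramMix T₀ tₛ tₜ tₛₜ A₀ Aₛ Aₜ Aₛₜ) qₛₜ)
          + 2 * hessT (τ * W₀)⁻¹ (τ * wₛ) (τ * wₜ) (τ * wₛₜ)) := by
  have h := hessT_transfer_wardL_lift hc K₀ kₛ kₜ kₛₜ T₀ tₛ tₜ tₛₜ A₀ Aₛ Aₜ Aₛₜ W₀ wₛ wₜ wₛₜ Q₀ qₛ qₜ qₛₜ τ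
    hK₀ hkₛ hkₜ hkₛₜ hA₀ hAₛ hAₜ hAₛₜ a0 aₛ aₜ aₛₜ b0 bₛ bₜ bₛₜ hTW hA hΦ hτ hM
  rw [one_kronecker_add_gram₀, kronecker_add_gram₁ hc, kronecker_add_gram₁ hc, sq_kronecker_add_gramMix hc,
    -- M-side
    kkt_kronecker_symm Matrix.transpose_one, corner_inv_lift, kkt_kronecker₂_tj₂ hc, kkt_kronecker₂_tj₂ hc,
    kkt_kronecker₂_symm (sq_transpose hc), hessT_reindex_lift, hessT_kronecker_lift,
    -- Φ-side
    gram₀_lift, gram₁_lift hc, gram₁_lift hc, gramMix_lift hc, inv_one_kronecker, hessT_kronecker_lift,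
    -- N-side
    kkt_kronecker₂_symm Matrix.transpose_one, kkt_kronecker₂_tj₂ hc, kkt_kronecker₂_tj₂ hc, kkt_kronecker₂_symm (sq_transpose hc),
    inv_reindex_one_kronecker, hessT_reindex_lift, hessT_kronecker_lift,
    -- comb-FP side
    lift_mul, lift_mul, lift_mul, lift_mul, inv_one_kronecker, hessT_kronecker_lift] at h
  linear_combination h

/-- [folklore] **«K-COV-C» — THE COLOUR-STRIPPED SLICE TRANSFER OF THE COVARIANT ORGANISATION** (`c = cgen`, `tr(C²) = −2` cancelled).
For COLOURLESS typed data — `K₀`, `kₛₜ`, `A₀`, `Aₛₜ` symmetric, `kₛ`, `kₜ`, `Aₛ`, `Aₜ` ANTISYMMETRIC — satisfying ONLY the colourless ONE-SIDED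
WARD-L letters `K₀W₀ = 0`, `kₛW₀ + K₀wₛ = 0`, `kₜW₀ + K₀wₜ = 0`, `kₛₜW₀ + kₛwₜ + kₜwₛ + K₀wₛₜ = 0`, the kinematic letters, and the five `det ≠ 0`:
`hessT (M⁻¹|_{ν⊕μ}; tj₂ kₛ qₛ, tj₂ kₜ qₜ, kkt kₛₜ qₛₜ) + hessT (Φ₀⁻¹; tgram₁ W₀ wₛ Y₀ ỹₛ, tgram₁ W₀ wₜ Y₀ ỹₜ, tgramMix W₀ w• Y₀ ỹ•)
 = hessT ((kkt Y₀ Q₀)⁻¹; tj₂ ỹₛ qₛ, tj₂ ỹₜ qₜ, kkt ỹₛₜ qₛₜ) + 2·hessT ((τW₀)⁻¹; τwₛ, τwₜ, τwₛₜ)`,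
`M = kkt K₀ [Q₀;τ]`, `Y₀ = K₀ + gram₀ T₀ A₀`, `Φ₀ = gram₀ W₀ Y₀`, `ỹₛ = kₛ + tgram₁ T₀ tₛ A₀ Aₛ`, `ỹₛₜ = kₛₜ + tgramMix T₀ t• A₀ A•` — SIGNED first jets
`tj₂ k q = [[k, −qᵀ],[q, 0]]`, untwisted second jets, TWISTED Gram jets.  (The honest-symmetric `KCombineCov.hessT_transfer_wardL` is the `c = 1`-type
statement; this is the one the cell's parity-odd first-order tables instantiate.) -/
theorem hessT_transfer_wardL_stripped
    (K₀ kₛ kₜ kₛₜ : Matrix ν ν ℝ) (T₀ tₛ tₜ tₛₜ : Matrix ρ ν ℝ) (A₀ Aₛ Aₜ Aₛₜ : Matrix ρ ρ ℝ)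
    (W₀ wₛ wₜ wₛₜ : Matrix ν ρ ℝ) (Q₀ qₛ qₜ qₛₜ : Matrix μ ν ℝ) (τ : Matrix ρ ν ℝ)
    (hK₀ : K₀ᵀ = K₀) (hkₛ : kₛᵀ = -kₛ) (hkₜ : kₜᵀ = -kₜ) (hkₛₜ : kₛₜᵀ = kₛₜ)
    (hA₀ : A₀ᵀ = A₀) (hAₛ : Aₛᵀ = -Aₛ) (hAₜ : Aₜᵀ = -Aₜ) (hAₛₜ : Aₛₜᵀ = Aₛₜ)
    (a0 : K₀ * W₀ = 0) (aₛ : kₛ * W₀ + K₀ * wₛ = 0) (aₜ : kₜ * W₀ + K₀ * wₜ = 0)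
    (aₛₜ : kₛₜ * W₀ + kₛ * wₜ + kₜ * wₛ + K₀ * wₛₜ = 0)
    (b0 : Q₀ * W₀ = 0) (bₛ : qₛ * W₀ + Q₀ * wₛ = 0) (bₜ : qₜ * W₀ + Q₀ * wₜ = 0)
    (bₛₜ : qₛₜ * W₀ + qₛ * wₜ + qₜ * wₛ + Q₀ * wₛₜ = 0)
    (hTW : (T₀ * W₀).det ≠ 0) (hA : A₀.det ≠ 0) (hΦ : (gram₀ W₀ (K₀ + gram₀ T₀ A₀)).det ≠ 0) (hτ : (τ * W₀).det ≠ 0)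
    (hM : (kkt K₀ (fromRows Q₀ τ)).det ≠ 0) :
    hessT ((kkt K₀ (fromRows Q₀ τ))⁻¹.submatrix (Sum.map id Sum.inl) (Sum.map id Sum.inl)) (tj₂ kₛ qₛ) (tj₂ kₜ qₜ) (kkt kₛₜ qₛₜ)
        + hessT (gram₀ W₀ (K₀ + gram₀ T₀ A₀))⁻¹
            (tgram₁ W₀ wₛ (K₀ + gram₀ T₀ A₀) (kₛ + tgram₁ T₀ tₛ A₀ Aₛ))
            (tgram₁ W₀ wₜ (K₀ + gram₀ T₀ A₀) (kₜ + tgram₁ T₀ tₜ A₀ Aₜ))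
            (tgramMix W₀ wₛ wₜ wₛₜ (K₀ + gram₀ T₀ A₀) (kₛ + tgram₁ T₀ tₛ A₀ Aₛ) (kₜ + tgram₁ T₀ tₜ A₀ Aₜ)
              (kₛₜ + tgramMix T₀ tₛ tₜ tₛₜ A₀ Aₛ Aₜ Aₛₜ))
      = hessT (kkt (K₀ + gram₀ T₀ A₀) Q₀)⁻¹ (tj₂ (kₛ + tgram₁ T₀ tₛ A₀ Aₛ) qₛ) (tj₂ (kₜ + tgram₁ T₀ tₜ A₀ Aₜ) qₜ)
            (kkt (kₛₜ + tgramMix T₀ tₛ tₜ tₛₜ A₀ Aₛ Aₜ Aₛₜ) qₛₜ)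
        + 2 * hessT (τ * W₀)⁻¹ (τ * wₛ) (τ * wₜ) (τ * wₛₜ) := by
  have h := hessT_transfer_wardL_stripped_mul cgen_transpose K₀ kₛ kₜ kₛₜ T₀ tₛ tₜ tₛₜ A₀ Aₛ Aₜ Aₛₜ W₀ wₛ wₜ wₛₜ Q₀ qₛ qₜ qₛₜ τ
    hK₀ hkₛ hkₜ hkₛₜ hA₀ hAₛ hAₜ hAₛₜ a0 aₛ aₜ aₛₜ b0 bₛ bₜ bₛₜ hTW hA hΦ hτ hM
  rw [trace_cgen_mul_cgen] at h
  linarith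

end Strip

/-! ## §4 The M-side in the cell's `D`-placement -/

section Placed

variable {ν μ ρ : Type*} [Fintype ν] [Fintype μ] [Fintype ρ] [DecidableEq ν] [DecidableEq μ] [DecidableEq ρ]

/-- [folklore] With `D = diag(1, −1)` on `ν ⊕ μ`: `hessT L (tj₂ k q) (tj₂ k′ q′) w = hessT L (kkt k q · D) (kkt k′ q′ · D) w` — the signed first jets ARE the
placed bordered jets (`ColourLiftPackedHess.tj₂_eq_kkt_mul_sgn`). -/
theorem hessT_tj₂_eq_placed (L w : Matrix (ν ⊕ μ) (ν ⊕ μ) ℝ) (k k' : Matrix ν ν ℝ) (q q' : Matrix μ ν ℝ) :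
    hessT L (tj₂ k q) (tj₂ k' q') w
      = hessT L (kkt k q * Matrix.fromBlocks (1 : Matrix ν ν ℝ) 0 0 (-1 : Matrix μ μ ℝ))
          (kkt k' q' * Matrix.fromBlocks (1 : Matrix ν ν ℝ) 0 0 (-1 : Matrix μ μ ℝ)) w := by
  rw [tj₂_eq_kkt_mul_sgn, tj₂_eq_kkt_mul_sgn]

/-- [folklore] **«K-COV-C» IN THE CELL's PLACEMENT**: if the M-leg corner is read as `D·L` for an `L` (TB1: `hessT_inv_MT_corner` reads the comb KKT
corner through `D = diag(1,−1)`), then the stripped M-side functional is `hessT L (kkt kₛ qₛ) (kkt kₜ qₜ) (kkt kₛₜ qₛₜ · D)` — first-order tables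
`V = j·D = kkt k q` PLAIN (symmetric border twin, antisymmetric field block: parity-odd), second-order table `W = w·D` (F-g6-1 verbatim). -/
theorem hessT_stripped_M_placed {L : Matrix (ν ⊕ μ) (ν ⊕ μ) ℝ} {C : Matrix (ν ⊕ μ) (ν ⊕ μ) ℝ}
    (hC : C = Matrix.fromBlocks (1 : Matrix ν ν ℝ) 0 0 (-1 : Matrix μ μ ℝ) * L)
    (kₛ kₜ kₛₜ : Matrix ν ν ℝ) (qₛ qₜ qₛₜ : Matrix μ ν ℝ) :
    hessT C (tj₂ kₛ qₛ) (tj₂ kₜ qₜ) (kkt kₛₜ qₛₜ)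
      = hessT L (kkt kₛ qₛ) (kkt kₜ qₜ) (kkt kₛₜ qₛₜ * Matrix.fromBlocks (1 : Matrix ν ν ℝ) 0 0 (-1 : Matrix μ μ ℝ)) := by
  have hD := sgn_mul_sgn (ν := ν) (μ := μ)
  rw [hC, tj₂_eq_kkt_mul_sgn, tj₂_eq_kkt_mul_sgn,
    show hessT (Matrix.fromBlocks (1 : Matrix ν ν ℝ) 0 0 (-1 : Matrix μ μ ℝ) * L)
        (kkt kₛ qₛ * Matrix.fromBlocks (1 : Matrix ν ν ℝ) 0 0 (-1 : Matrix μ μ ℝ))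
        (kkt kₜ qₜ * Matrix.fromBlocks (1 : Matrix ν ν ℝ) 0 0 (-1 : Matrix μ μ ℝ)) (kkt kₛₜ qₛₜ)
      = hessT (Matrix.fromBlocks (1 : Matrix ν ν ℝ) 0 0 (-1 : Matrix μ μ ℝ) * L)
        (kkt kₛ qₛ * Matrix.fromBlocks (1 : Matrix ν ν ℝ) 0 0 (-1 : Matrix μ μ ℝ))
        (kkt kₜ qₜ * Matrix.fromBlocks (1 : Matrix ν ν ℝ) 0 0 (-1 : Matrix μ μ ℝ))
        (kkt kₛₜ qₛₜ * Matrix.fromBlocks (1 : Matrix ν ν ℝ) 0 0 (-1 : Matrix μ μ ℝ) * Matrix.fromBlocks (1 : Matrix ν ν ℝ) 0 0 (-1 : Matrix μ μ ℝ)) by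
      rw [Matrix.mul_assoc (kkt kₛₜ qₛₜ), hD, Matrix.mul_one]]
  exact hessT_placement hD L _ _ _

end Placed

end Summit.QuantumFields.BalabanUV.Beta.D1BFx.KCombineCovColour

end
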